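import Summits.BirchSwinnertonDyer.BirchSwinnertonDyer.Theorems.SmallImageMuTransferMuTransferX9CentralScalarOdd
import Summits.BirchSwinnertonDyer.BirchSwinnertonDyer.Theorems.KatoDescentPotSupersingularIrreducibleThreeCyclotomicDisjoint
import Summits.BirchSwinnertonDyer.Rank1Residual.GaloisImage.IrreducibleModThreeCentralInvolution
import HarnessLib

/-!
# The K6 `μ`-core under IMAGE FACTS instead of `ρ̄` not onto — part A: (F2)/(F8), the central scalar and
# the Sah bridge at every prime, with the `p = 3` discharge from `E[3]` irreducible ALONE
# (route `KatoDescentPotSupersingular`, U₀ parent item stmt-BirchSwinnertonDyer-19197 / U₀-ns node 19189;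
# route-free helper)

Seat `bsd-potss-k9-c4` g14 (prover; cell `bsd-potss`); `--supports stmt-BirchSwinnertonDyer-19197 --as helper`;
closes nothing.  HONEST FRAMING: BSD is not proved by any of this; nothing is booked; THEOREMS ONLY; the mathematics
and the proof texts are the K6 cells' (`bsd-smallim` k6-c2/koly/lur, `b2b-bsdres` x9/x10; MU-TRANSFER-PROOF §§1–5);
this file only re-keys their hypotheses.

## What

The K6 kernel `μ`-core (`Rank1Residual.CoreAssembly.coreOdd_anyReduction_holds`: a genuine Λ-adic Euler-system
class `s ∉ p𝐇¹` kills the `T`-divisible growth of `Sel₀(ℚ_∞, E[p^∞])[p]`), the engine of rkm g15's fine road on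
the U₀-ns rows of K9/K8-t′, carries the binder `¬ W.HasSurjectiveModNGaloisRep p`.  That binder is consumed
(k9-c4 g14 census of all 26 core files) only through TWO image facts:

* **(SC)** `∃ z ∈ Γ_ℚ, ∃ a ∈ 𝔽_p, a ≠ 1 ∧ z|_{E[p]} = a` — a Galois scalar `≠ 1` on `E[p]`;
* **(IF)** no NORMAL subgroup of `Γ_ℚ` containing `ker ρ̄_{E,p}` has index `p` — i.e. `ℚ(E[p])` contains no
  cyclic degree-`p` subfield, whence (F2)/(F8) `ℚ(E[p]) ∩ ℚ_∞ = ℚ` for every `ℤ_p`-extension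
  (`IrrThreeDisjoint.ZpImage.map_eq_top_of_forall_normal_index_ne`, p586474).

This file (part A; part B = `…MuCoreIrrStepOne`) re-runs, with `(hSC) (hIF)` in place of `¬Surj` and the K6
proof texts otherwise verbatim: §1 (F2)/(F8) at every prime from (IF); §2 the central scalar inside `ker κ` and
the Sah bridge on `𝒯_J(E)` (CentralScalar/CentralScalarOdd twins); §5 **the `p = 3` discharge: `E[3]`
irreducible ⟹ (SC)** ((IF) at `p = 3` is `IrrThreeDisjoint.forall_normal_index_ne_three_of_irr`, p586474)
(`GaloisImage.exists_smul_eq_neg_three_of_irr`, stepL/b2b; `IrrThreeDisjoint.forall_normal_index_ne_three_of_irr`,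
k9-c4 g14) — so every theorem here holds on ALL `E[3]`-irreducible rows, the 9-deficient ones (ρ̄₃ onto, ρ̄₉
not) included, where `3 ∣ #ρ̄₃(Γ_ℚ) = 48` and the K6 binder is unavailable.

References: [Serre1972] §2.4 Prop. 15, §2.5–2.6; [Sah1968] Prop. 2.7 (b); [Washington1997] §13.1–13.2;
[MazurRubin2004] §5.3; tree files named above.
-/

-- the summit and its single problem are both named `BirchSwinnertonDyer` (registry layout D-0017)
set_option linter.dupNamespace false
set_option autoImplicit false

noncomputable section

open Field WeierstrassCurve Literature.NumberTheory.EllipticCurves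
  Literature.NumberTheory.GaloisRepresentations Function

namespace Summit.BirchSwinnertonDyer.BirchSwinnertonDyer.Rank1Residual

/-! ## §1 (F2)/(F8) at every prime from (IF) -/

section ImageFacts

variable (W : WeierstrassCurve ℚ) [W.IsElliptic] (p : ℕ) [Fact p.Prime] (κ : ZpExtension ℚ p)

/-- `Aut(E[p])` is finite, so `[Γ_ℚ : ker ρ̄_{E,p}] = #ρ̄_{E,p}(Γ_ℚ) ≠ 0`. [cite: Serre1972, §2.5] -/
theorem index_ker_galoisRepTorsion_ne_zero : (galoisRepTorsion W p).ker.index ≠ 0 := by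
  obtain ⟨-, Φ, -⟩ := exists_frame_galoisRepTorsion_rat W p
  haveI : Finite (Multiplicative (AddAut (geomTorsion W p))) := Finite.of_equiv _ Φ.toEquiv.symm
  rw [Subgroup.index_ker]
  exact Nat.card_pos.ne'

/-- **(F2) `κ(Gal(ℚ̄/ℚ(E[p]))) = ℤ_p`** from (IF), for every `ℤ_p`-extension `κ`.
[cite: Washington1997, §13.1] [cite: Serre1972, §2.4 Prop. 15] -/
theorem map_ker_galoisRepTorsion_eq_top_of_IF
    (hIF : ∀ N : Subgroup (absoluteGaloisGroup ℚ), N.Normal → (galoisRepTorsion W p).ker ≤ N →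
      N.index ≠ p) :
    (galoisRepTorsion W p).ker.map κ.toContinuousMonoidHom.toMonoidHom = ⊤ :=
  Theorems.IrrThreeDisjoint.ZpImage.map_eq_top_of_forall_normal_index_ne _ κ.surjective _
    (index_ker_galoisRepTorsion_ne_zero W p) hIF

/-- **(F2)/(F8) `(ρ̄_{E,p}, κ) : Γ_ℚ ↠ Ḡ × ℤ_p`** from (IF). [cite: Washington1997, §13.1]
[cite: Serre1972, §2.4 Prop. 15] -/
theorem exists_galoisRepTorsion_eq_and_eq_of_IF
    (hIF : ∀ N : Subgroup (absoluteGaloisGroup ℚ), N.Normal → (galoisRepTorsion W p).ker ≤ N →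
      N.index ≠ p)
    (τ : absoluteGaloisGroup ℚ) (y : Multiplicative ℤ_[p]) :
    ∃ σ : absoluteGaloisGroup ℚ, galoisRepTorsion W p σ = galoisRepTorsion W p τ ∧ κ σ = y :=
  Theorems.IrrThreeDisjoint.ZpImage.exists_ker_eq_and_eq (galoisRepTorsion W p)
    κ.toContinuousMonoidHom.toMonoidHom κ.surjective (index_ker_galoisRepTorsion_ne_zero W p) hIF τ y

/-- **(F8) `Γ_ℚ = ker ρ̄_{E,p} · Gal(ℚ̄/ℚ_n)`** at every layer, from (IF). [cite: Washington1997, §13.1] -/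
theorem ker_galoisRepTorsion_sup_layerSubgroup_eq_top_of_IF
    (hIF : ∀ N : Subgroup (absoluteGaloisGroup ℚ), N.Normal → (galoisRepTorsion W p).ker ≤ N →
      N.index ≠ p) (n : ℕ) :
    (galoisRepTorsion W p).ker ⊔ κ.layerSubgroup n = ⊤ :=
  Theorems.IrrThreeDisjoint.ZpImage.ker_sup_eq_top_of_ker_le (galoisRepTorsion W p)
    κ.toContinuousMonoidHom.toMonoidHom κ.surjective (index_ker_galoisRepTorsion_ne_zero W p) hIF _
    (κ.kerSubgroup_le_layerSubgroup n)

/-- **`Γ_ℚ = ker ρ̄_{E,p} · Gal(ℚ̄/ℚ_∞)`** from (IF). [cite: Washington1997, §13.1] -/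
theorem ker_galoisRepTorsion_sup_kerSubgroup_eq_top_of_IF
    (hIF : ∀ N : Subgroup (absoluteGaloisGroup ℚ), N.Normal → (galoisRepTorsion W p).ker ≤ N →
      N.index ≠ p) :
    (galoisRepTorsion W p).ker ⊔ κ.kerSubgroup = ⊤ :=
  Theorems.IrrThreeDisjoint.ZpImage.ker_sup_eq_top_of_ker_le (galoisRepTorsion W p)
    κ.toContinuousMonoidHom.toMonoidHom κ.surjective (index_ker_galoisRepTorsion_ne_zero W p) hIF _
    le_rfl

/-- **A topological generator of `κ` FIXING `E[p]`** from (IF) (the hypotheses of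
`LevelE.modPTwist_stable_addSubgroup_eq_tPow`, p432130). [cite: Washington1997, §13.1–§13.2] -/
theorem exists_isTopGenerator_forall_smul_eq_of_IF
    (hIF : ∀ N : Subgroup (absoluteGaloisGroup ℚ), N.Normal → (galoisRepTorsion W p).ker ≤ N →
      N.index ≠ p) :
    ∃ γ₀ : absoluteGaloisGroup ℚ, κ.IsTopGenerator γ₀ ∧ ∀ P : geomTorsion W p, γ₀ • P = P := by
  obtain ⟨σ, h1, h2⟩ := exists_galoisRepTorsion_eq_and_eq_of_IF W p κ hIF 1 (Multiplicative.ofAdd 1)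
  refine ⟨σ, h2, fun P ↦ ?_⟩
  rw [← galoisRepTorsion_apply, h1, map_one]
  rfl

/-- **The depth elements** (twin of `exists_mem_ker_inf_layerSubgroup_not_mem_layerSubgroup_succ`): from
(IF), some `σ ∈ ker ρ̄_{E,p} ⊓ Gal(ℚ̄/ℚ_n)` lies outside `Gal(ℚ̄/ℚ_{n+1})`. [cite: Washington1997, §13.1] -/
theorem exists_mem_ker_inf_layerSubgroup_not_mem_layerSubgroup_succ_of_IF
    (hIF : ∀ N : Subgroup (absoluteGaloisGroup ℚ), N.Normal → (galoisRepTorsion W p).ker ≤ N →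
      N.index ≠ p) (n : ℕ) :
    ∃ σ ∈ (galoisRepTorsion W p).ker ⊓ κ.layerSubgroup n, σ ∉ κ.layerSubgroup (n + 1) := by
  obtain ⟨σ, hρ, hκ⟩ := exists_galoisRepTorsion_eq_and_eq_of_IF W p κ hIF 1
    (Multiplicative.ofAdd ((p : ℤ_[p]) ^ n))
  have hp : Prime (p : ℤ_[p]) := PadicInt.prime_p
  refine ⟨σ, Subgroup.mem_inf.mpr ⟨?_, ?_⟩, ?_⟩
  · rw [MonoidHom.mem_ker, hρ, map_one]
  · rw [ZpExtension.mem_layerSubgroup, hκ, toAdd_ofAdd]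
  · rw [ZpExtension.mem_layerSubgroup, hκ, toAdd_ofAdd, pow_dvd_pow_iff hp.ne_zero hp.not_unit]
    omega

/-- Value form of the depth element (twin of `exists_galoisRepTorsion_eq_one_and_eq_pow_mul`): `κ` maps
`ker ρ̄_{E,p} ⊓ Gal(ℚ̄/ℚ_n)` ONTO `pⁿ ℤ_p`. [cite: Washington1997, §13.1] -/
theorem exists_galoisRepTorsion_eq_one_and_eq_pow_mul_of_IF
    (hIF : ∀ N : Subgroup (absoluteGaloisGroup ℚ), N.Normal → (galoisRepTorsion W p).ker ≤ N →
      N.index ≠ p) (n : ℕ) (y : ℤ_[p]) :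
    ∃ σ ∈ (galoisRepTorsion W p).ker ⊓ κ.layerSubgroup n,
      κ σ = Multiplicative.ofAdd ((p : ℤ_[p]) ^ n * y) := by
  obtain ⟨σ, hρ, hκ⟩ := exists_galoisRepTorsion_eq_and_eq_of_IF W p κ hIF 1
    (Multiplicative.ofAdd ((p : ℤ_[p]) ^ n * y))
  refine ⟨σ, Subgroup.mem_inf.mpr ⟨?_, ?_⟩, hκ⟩
  · rw [MonoidHom.mem_ker, hρ, map_one]
  · rw [ZpExtension.mem_layerSubgroup, hκ, toAdd_ofAdd]
    exact dvd_mul_right _ _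

end ImageFacts

/-! ## §2 The central scalar inside `ker κ` and the Sah bridge on `𝒯_J(E)`, from (SC) + (IF) -/

section Scalar

variable (W : WeierstrassCurve ℚ) [W.IsElliptic] (p : ℕ) [Fact p.Prime] (κ : ZpExtension ℚ p)

/-- **The central scalar inside `Gal(ℚ̄/ℚ_∞)`** (twin of `exists_mem_kerSubgroup_smul_eq_of_ne_two`): from
(SC) and (IF), some `σ₀ ∈ ker κ` acts on `E[p]` as a scalar `a ≠ 1` (move the scalar of (SC) into `ker κ`
along the joint surjectivity of §1). [cite: Serre1972, §2.6] [cite: Washington1997, §13.1] -/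
theorem exists_mem_kerSubgroup_smul_eq_of_imageFacts
    (hSC : ∃ (z : absoluteGaloisGroup ℚ) (a : ZMod p), a ≠ 1 ∧ ∀ P : geomTorsion W p, z • P = a.val • P)
    (hIF : ∀ N : Subgroup (absoluteGaloisGroup ℚ), N.Normal → (galoisRepTorsion W p).ker ≤ N →
      N.index ≠ p) :
    ∃ (σ₀ : absoluteGaloisGroup ℚ) (a : ZMod p), a ≠ 1 ∧ σ₀ ∈ κ.kerSubgroup ∧
      ∀ P : geomTorsion W p, σ₀ • P = a.val • P := by
  obtain ⟨z, a, ha1, hz⟩ := hSC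
  obtain ⟨σ₀, hρ, hκ⟩ := exists_galoisRepTorsion_eq_and_eq_of_IF W p κ hIF z 1
  refine ⟨σ₀, a, ha1, ZpExtension.mem_kerSubgroup.mpr hκ, fun P => ?_⟩
  rw [← galoisRepTorsion_apply, hρ, galoisRepTorsion_apply]
  exact hz P

/-- **Sah on the genuine `𝒯_J(E)`** (twin of `modPTwist_oneCocycleClass_eq_of_forall_mem_eq_of_ne_two`): two
continuous 1-cocycles of `Γ_ℚ` in `W.modPTwist p κ J` agreeing on `ker ρ̄_{E,p} ⊓ ker κ` have the same class.
[cite: Sah1968, Prop. 2.7 (b)] [cite: Serre1972, §2.6] -/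
theorem modPTwist_oneCocycleClass_eq_of_forall_mem_eq_of_imageFacts
    (hSC : ∃ (z : absoluteGaloisGroup ℚ) (a : ZMod p), a ≠ 1 ∧ ∀ P : geomTorsion W p, z • P = a.val • P)
    (hIF : ∀ N : Subgroup (absoluteGaloisGroup ℚ), N.Normal → (galoisRepTorsion W p).ker ≤ N →
      N.index ≠ p) (J : ℕ)
    (φ ψ : contOneCocycles (W.modPTwist p κ J).toTopRep)
    (hN : ∀ ν ∈ (galoisRepTorsion W p).ker ⊓ κ.kerSubgroup, φ.1 ν = ψ.1 ν) :
    oneCocycleClass _ φ = oneCocycleClass _ ψ := by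
  obtain ⟨σ₀, a, ha1, hκ, hσ₀⟩ := exists_mem_kerSubgroup_smul_eq_of_imageFacts W p κ hSC hIF
  exact modPTwist_oneCocycleClass_eq_of_forall_mem_eq_of_smul_eq W p κ ha1 hκ hσ₀ J φ ψ hN

/-- Vanishing form (twin of `modPTwist_oneCocycleClass_eq_zero_of_forall_mem_eq_zero_of_ne_two`).
[cite: Sah1968, Prop. 2.7 (b)] [cite: Serre1972, §2.6] -/
theorem modPTwist_oneCocycleClass_eq_zero_of_forall_mem_eq_zero_of_imageFacts
    (hSC : ∃ (z : absoluteGaloisGroup ℚ) (a : ZMod p), a ≠ 1 ∧ ∀ P : geomTorsion W p, z • P = a.val • P)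
    (hIF : ∀ N : Subgroup (absoluteGaloisGroup ℚ), N.Normal → (galoisRepTorsion W p).ker ≤ N →
      N.index ≠ p) (J : ℕ)
    (φ : contOneCocycles (W.modPTwist p κ J).toTopRep)
    (hN : ∀ ν ∈ (galoisRepTorsion W p).ker ⊓ κ.kerSubgroup, φ.1 ν = 0) :
    oneCocycleClass _ φ = 0 := by
  obtain ⟨σ₀, a, ha1, hκ, hσ₀⟩ := exists_mem_kerSubgroup_smul_eq_of_imageFacts W p κ hSC hIF
  exact modPTwist_oneCocycleClass_eq_zero_of_forall_mem_eq_zero_of_smul_eq W p κ ha1 hκ hσ₀ J φ hN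

/-- The literal (F8) reading (twin of `modPTwist_oneCocycleClass_eq_of_forall_mem_layerSubgroup_eq_of_ne_two`):
agreement on `ker ρ̄_{E,p} ⊓ Gal(ℚ̄/ℚ_n)` suffices. [cite: Sah1968, Prop. 2.7 (b)] [cite: Serre1972, §2.6] -/
theorem modPTwist_oneCocycleClass_eq_of_forall_mem_layerSubgroup_eq_of_imageFacts
    (hSC : ∃ (z : absoluteGaloisGroup ℚ) (a : ZMod p), a ≠ 1 ∧ ∀ P : geomTorsion W p, z • P = a.val • P)
    (hIF : ∀ N : Subgroup (absoluteGaloisGroup ℚ), N.Normal → (galoisRepTorsion W p).ker ≤ N →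
      N.index ≠ p) (J n : ℕ)
    (φ ψ : contOneCocycles (W.modPTwist p κ J).toTopRep)
    (hN : ∀ ν ∈ (galoisRepTorsion W p).ker ⊓ κ.layerSubgroup n, φ.1 ν = ψ.1 ν) :
    oneCocycleClass _ φ = oneCocycleClass _ ψ :=
  modPTwist_oneCocycleClass_eq_of_forall_mem_eq_of_imageFacts W p κ hSC hIF J φ ψ fun ν hν =>
    hN ν (Subgroup.mem_inf.mpr
      ⟨(Subgroup.mem_inf.mp hν).1, κ.kerSubgroup_le_layerSubgroup n (Subgroup.mem_inf.mp hν).2⟩)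

/-- Dual side (twin of `invTwist_modPTwist_oneCocycleClass_eq_of_forall_mem_eq_of_ne_two`): the same for
`W.modPTwist p κ.invTwist J`. [cite: Sah1968, Prop. 2.7 (b)] [cite: Serre1972, §2.6] -/
theorem invTwist_modPTwist_oneCocycleClass_eq_of_forall_mem_eq_of_imageFacts
    (hSC : ∃ (z : absoluteGaloisGroup ℚ) (a : ZMod p), a ≠ 1 ∧ ∀ P : geomTorsion W p, z • P = a.val • P)
    (hIF : ∀ N : Subgroup (absoluteGaloisGroup ℚ), N.Normal → (galoisRepTorsion W p).ker ≤ N →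
      N.index ≠ p) (J : ℕ)
    (φ ψ : contOneCocycles (W.modPTwist p κ.invTwist J).toTopRep)
    (hN : ∀ ν ∈ (galoisRepTorsion W p).ker ⊓ κ.kerSubgroup, φ.1 ν = ψ.1 ν) :
    oneCocycleClass _ φ = oneCocycleClass _ ψ := by
  obtain ⟨σ₀, a, ha1, hκ, hσ₀⟩ := exists_mem_kerSubgroup_smul_eq_of_imageFacts W p κ hSC hIF
  exact invTwist_modPTwist_oneCocycleClass_eq_of_forall_mem_eq_of_smul_eq W p κ ha1 hκ hσ₀ J φ ψ hN

end Scalar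

/-! ## §5 The `p = 3` discharge: `E[3]` irreducible ⟹ (SC) ∧ (IF) -/

section Three

variable (W : WeierstrassCurve ℚ) [W.IsElliptic]

/-- **(SC) at `p = 3` for EVERY `E/ℚ` with `E[3]` irreducible**: some `z ∈ Γ_ℚ` acts on `E[3]` as the scalar
`2 = −1 ≠ 1` (stepL/b2b `GaloisImage.exists_smul_eq_neg_three_of_irr`: the image contains `−1`, onto or not).
[cite: Serre1972, §2.5–2.6] -/
theorem imageFactSC_three_of_irr (hirr : W.HasIrreducibleModPGaloisRep 3) :
    haveI : Fact (Nat.Prime 3) := ⟨Nat.prime_three⟩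
    ∃ (z : absoluteGaloisGroup ℚ) (a : ZMod 3), a ≠ 1 ∧
      ∀ P : geomTorsion W (3 : ℕ), z • P = a.val • P := by
  obtain ⟨z, hz⟩ := _root_.Summit.BirchSwinnertonDyer.Rank1Residual.GaloisImage.exists_smul_eq_neg_three_of_irr W hirr
  refine ⟨z, 2, by decide, fun P => ?_⟩
  have h3 : (3 : ℕ) • P = 0 := AddSubgroup.torsionBy.nsmul P
  have h2 : (2 : ZMod 3).val = 2 := rfl
  rw [hz P, h2, eq_comm, ← sub_eq_zero, sub_neg_eq_add, ← succ_nsmul]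
  exact h3

-- (IF) at `p = 3` for every `E/ℚ` with `E[3]` irreducible is
-- `Theorems.IrrThreeDisjoint.forall_normal_index_ne_three_of_irr` (k9-c4 g14, p586474), used as is.

end Three

end Summit.BirchSwinnertonDyer.BirchSwinnertonDyer.Rank1Residual
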